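import Literature.MathematicalPhysics.QuantumManyBody.PeriodicSoftModeMarkov
import Literature.MathematicalPhysics.QuantumManyBody.PeriodicKineticBudget

/-!
# Soft-mode Markov bookkeeping on the torus, dilute form: Dyson–LSSY input and near-minimisers

Topic `Literature/MathematicalPhysics/QuantumManyBody`, namespace `BoseGas`; continuation of
`PeriodicSoftModeMarkov.lean`.

* `periodicGroundStateEnergy_le_one_add_mul_dilute` — Dyson–LSSY Thm 2.2 in the uniform dilute form
  with the potential's own scattering length: for measurable `v` of finite range with `a < ∞` and
  every `η > 0` there is `ρ₁ > 0` with `E₀^per(N,(N/ρ)^{1/3}) ≤ (1+η)·4πρaN` for `0 < ρ < ρ₁` and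
  all large `N` (from the proved `LSSY2005_upperBound_periodic_holds`: `E₀ ≤ 4πρ₁a(1 + Ca/b)N`,
  `ρ₁ = (N-1)/L³ ≤ ρ`, `a/b = a(4πρ₁/3)^{1/3} → 0`). [LSSY2005, Thm. 2.2 (2.14)]
* `condensate_ge_of_shellLaw_nearMinimiser` — for admissible `v` with `a > 0`, small `ρ` and large
  `N`: every periodic trial state within `(4πρa/5)N` of `E₀^per` that obeys the dyadic shell law of
  `PeriodicSoftModeMarkov.lean` with constant `A` below `κ = √(8πρa)` has
  `⟨Ψ,n₀Ψ⟩ ≥ (7/20)N - (4/3)A·8πρa` (energy `≤ 1.3·4πρaN`, tail `1.3·4πρa/κ² = 0.65`).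

Use (strategy census of crux `BECCovarianceTransport.SoftShellRelaxation`, stmt-12684): with the
crux's `A = C L³c` the subtracted term is `(4/3)C·32π^{3/2}√(ρa³)N`, so the occupation conjunct of
that crux, passed to the `t → ∞` limit of the normalised flow (a ground state, hence a
near-minimiser of every slack), yields the route target `FlowCondensate` with `c = 1/4` — the
ultraviolet modes, the number variances and the energy-excess decay are not needed for condensation.

## References

* [LSSY2005] E. H. Lieb, R. Seiringer, J. P. Solovej, J. Yngvason, *The Mathematics of the Bose Gas
  and its Condensation* (2005), Thm. 2.2 (2.14).
-/

noncomputable section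

open MeasureTheory Filter Set
open scoped ENNReal NNReal BigOperators Topology

namespace Literature.MathematicalPhysics.QuantumManyBody.BoseGas

/-! ### The Dyson–LSSY energy input, uniform dilute form -/

/-- **Dyson–LSSY upper bound, uniform dilute form** with the potential's own scattering length: for
a measurable potential of finite range and every `η > 0` there is `ρ₁ > 0` such that for
`0 < ρ < ρ₁`
and all large `N`, `E₀^per(N, (N/ρ)^{1/3}) ≤ (1+η)·4πρaN`. From the tree's proved
`LSSY2005_upperBound_periodic_holds` (`E₀ ≤ 4πρ₁a(1 + C a/b)N`, `ρ₁ = (N-1)/L³ ≤ ρ`,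
`a/b = a(4πρ₁/3)^{1/3} → 0`). [cite: LSSY2005, Thm. 2.2 (2.14)] -/
theorem periodicGroundStateEnergy_le_one_add_mul_dilute {v : ℝ → ℝ≥0∞} {R₀ : ℝ} (hv : Measurable v)
    (hvR : ∀ r, R₀ < r → v r = 0) (ha : scatteringLength v ≠ ⊤) {η : ℝ} (hη : 0 < η) :
    ∃ ρ₁ : ℝ, 0 < ρ₁ ∧ ∀ ρ : ℝ, 0 < ρ → ρ < ρ₁ → ∀ᶠ N : ℕ in atTop,
      periodicGroundStateEnergy v N (sideLength ρ N) ≤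
        ENNReal.ofReal ((1 + η) * (4 * Real.pi * ρ * (scatteringLength v).toReal * N)) := by
  obtain ⟨C, c, hC, hc, H⟩ := LSSY2005_upperBound_periodic_holds v R₀ hv hvR ha
  set a : ℝ := (scatteringLength v).toReal with ha_def
  have ha0 : 0 ≤ a := ENNReal.toReal_nonneg
  -- the smallness threshold (for `a = 0` any positive threshold works)
  set c' : ℝ := min c (η / C) with hc'
  have hc'pos : 0 < c' := lt_min hc (div_pos hη hC)
  set ρ₁ : ℝ := if a = 0 then 1 else 3 * (c' / a) ^ 3 / (4 * Real.pi) with hρ₁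
  have hρ₁pos : 0 < ρ₁ := by
    rw [hρ₁]; split_ifs with h
    · exact one_pos
    · have : 0 < a := lt_of_le_of_ne ha0 (Ne.symm h); positivity
  refine ⟨ρ₁, hρ₁pos, fun ρ hρ hρlt => ?_⟩
  filter_upwards [eventually_ge_atTop 2, (tendsto_sideLength_atTop hρ).eventually_gt_atTop (2 * R₀)]
    with N hN2 hLR
  have hN0 : 0 < N := by omega
  have hL : 0 < sideLength ρ N := by
    unfold sideLength; exact Real.rpow_pos_of_pos (div_pos (by exact_mod_cast hN0) hρ) _
  have hρL : (N : ℝ) / sideLength ρ N ^ 3 = ρ := div_sideLength_pow_three hρ hN0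
  generalize sideLength ρ N = L at hL hρL hLR ⊢
  -- the effective density `ρe = (N-1)/L³ ≤ ρ`
  set ρe : ℝ := ((N : ℝ) - 1) / L ^ 3 with hρe
  have hρe_le : ρe ≤ ρ := by
    rw [hρe, ← hρL]
    exact div_le_div_of_nonneg_right (by linarith) (by positivity)
  have hρe_pos : 0 < ρe := by
    rw [hρe]
    have : (2 : ℝ) ≤ N := by exact_mod_cast hN2
    exact div_pos (by linarith) (by positivity)
  have hx_pos : 0 < 4 * Real.pi * ρe / 3 := by positivity
  have hab_eq : a / (4 * Real.pi * ρe / 3) ^ (-(1 : ℝ) / 3) =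
      a * (4 * Real.pi * ρe / 3) ^ ((1 : ℝ) / 3) := by
    rw [show (-(1 : ℝ) / 3) = -(1 / 3) by norm_num, Real.rpow_neg hx_pos.le, div_inv_eq_mul]
  -- `a (4πρe/3)^{1/3} ≤ c'` (trivial if `a = 0`)
  have hab_le : a * (4 * Real.pi * ρe / 3) ^ ((1 : ℝ) / 3) ≤ c' := by
    by_cases haz : a = 0
    · rw [haz, zero_mul]; exact hc'pos.le
    · have hapos : 0 < a := lt_of_le_of_ne ha0 (Ne.symm haz)
      have hρ₁' : ρ₁ = 3 * (c' / a) ^ 3 / (4 * Real.pi) := by rw [hρ₁, if_neg haz]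
      have h1 : (4 * Real.pi * ρe / 3) ^ ((1 : ℝ) / 3) ≤ (4 * Real.pi * ρ / 3) ^ ((1 : ℝ) / 3) :=
        Real.rpow_le_rpow hx_pos.le (by gcongr) (by norm_num)
      have h2 : (4 * Real.pi * ρ / 3) ^ ((1 : ℝ) / 3) < (4 * Real.pi * ρ₁ / 3) ^ ((1 : ℝ) / 3) :=
        Real.rpow_lt_rpow (by positivity) (by gcongr) (by norm_num)
      have h3 : (4 * Real.pi * ρ₁ / 3) ^ ((1 : ℝ) / 3) = c' / a := by
        rw [hρ₁']
        have : 4 * Real.pi * (3 * (c' / a) ^ 3 / (4 * Real.pi)) / 3 = (c' / a) ^ 3 := by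
          field_simp
        rw [this, show ((1 : ℝ) / 3) = ((3 : ℕ) : ℝ)⁻¹ by norm_num,
          Real.pow_rpow_inv_natCast (by positivity) three_ne_zero]
      calc a * (4 * Real.pi * ρe / 3) ^ ((1 : ℝ) / 3)
          ≤ a * (c' / a) := by
            exact mul_le_mul_of_nonneg_left (h1.trans (h2.trans_eq h3).le) hapos.le
        _ = c' := by field_simp
  have hab_c : a / (4 * Real.pi * ρe / 3) ^ (-(1 : ℝ) / 3) ≤ c := by
    rw [hab_eq]; exact hab_le.trans (min_le_left _ _)
  have hab_C : C * (a / (4 * Real.pi * ρe / 3) ^ (-(1 : ℝ) / 3)) ≤ η := by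
    rw [hab_eq]
    have h1 : a * (4 * Real.pi * ρe / 3) ^ ((1 : ℝ) / 3) ≤ η / C := hab_le.trans (min_le_right _ _)
    calc C * (a * (4 * Real.pi * ρe / 3) ^ ((1 : ℝ) / 3)) ≤ C * (η / C) :=
          mul_le_mul_of_nonneg_left h1 hC.le
      _ = η := by field_simp
  -- apply Thm. 2.2
  have hU := H N L hN2 hL hLR
  simp only at hU
  have hU' := hU hab_c
  refine hU'.trans (ENNReal.ofReal_le_ofReal ?_)
  have hN' : (0 : ℝ) ≤ N := N.cast_nonneg
  have h0 : 0 ≤ 1 + C * (a / (4 * Real.pi * ρe / 3) ^ (-(1 : ℝ) / 3)) := by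
    rw [hab_eq]; positivity
  have h1 : 1 + C * (a / (4 * Real.pi * ρe / 3) ^ (-(1 : ℝ) / 3)) ≤ 1 + η := by linarith
  calc 4 * Real.pi * ρe * a * (1 + C * (a / (4 * Real.pi * ρe / 3) ^ (-(1 : ℝ) / 3))) * N
      ≤ 4 * Real.pi * ρ * a * (1 + η) * N := by gcongr
    _ = (1 + η) * (4 * Real.pi * ρ * a * N) := by ring

/-! ### The costume theorem, near-minimiser form -/

/-- **Costume theorem (near-minimiser form).** For every repulsive finite-range `v` with positive
scattering length `a` there is `ρ₁ > 0` such that for `0 < ρ < ρ₁` and all large `N`, on the torus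
of side `L = (N/ρ)^{1/3}`: every periodic trial state `Ψ` with
`⟨Ψ,HΨ⟩ ≤ E₀^per + (4πρa/5)·N` that satisfies the occupation conjunct of `SoftShellRelaxation` with
constant `A` (per dyadic shell `B_j` below `κ = √(8πρa)`: `≤ A k_j²`) has
`⟨Ψ, n₀Ψ⟩ ≥ (7/20)·N - (4/3)·A·(8πρa)`. (Energy `≤ 1.1·4πρaN + 0.2·4πρaN = 1.3·4πρaN`, and
`1.3·4πρa/κ² = 0.65`.) With the crux's `A = C·L³·c` the subtracted term is
`(4/3)·C·32π^{3/2}√(ρa³)·N`. Applied to the `t → ∞` limit of the normalised flow (a ground state,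
hence a near-minimiser of every slack) this is `FlowCondensate` with `c = 1/4` at small `ρa³`.
[cite: LSSY2005, Thm. 2.2 (2.14)] -/
theorem condensate_ge_of_shellLaw_nearMinimiser {v : ℝ → ℝ≥0∞} (hv : IsRepulsiveFiniteRange v)
    (hapos : 0 < (scatteringLength v).toReal) :
    ∃ ρ₁ : ℝ, 0 < ρ₁ ∧ ∀ ρ : ℝ, 0 < ρ → ρ < ρ₁ → ∀ᶠ N : ℕ in atTop,
      ∀ (Ψ : PeriodicTrialState N (sideLength ρ N)) (A : ℝ), 0 ≤ A →
        let a : ℝ := (scatteringLength v).toReal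
        let L : ℝ := sideLength ρ N
        let κ : ℝ := Real.sqrt (8 * Real.pi * ρ * a)
        (∀ j : ℕ, ∀ S : Finset (Fin 3 → ℤ),
          (∀ n ∈ S,
            κ * 2⁻¹ ^ j / 2 < 2 * Real.pi * Real.sqrt (∑ k : Fin 3, ((n k : ℤ) : ℝ) ^ 2) / L ∧
              2 * Real.pi * Real.sqrt (∑ k : Fin 3, ((n k : ℤ) : ℝ) ^ 2) / L ≤ κ * 2⁻¹ ^ j) →
            ∑ n ∈ S, cellOccupation N L (planeWaveMode L n) Ψ.ψ ≤
              ENNReal.ofReal (A * (κ * 2⁻¹ ^ j) ^ 2)) →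
        periodicEnergy v Ψ ≤ periodicGroundStateEnergy v N L +
            ENNReal.ofReal (4 * Real.pi * ρ * a / 5 * N) →
        ENNReal.ofReal (7 / 20 * N - 4 / 3 * A * (8 * Real.pi * ρ * a)) ≤
          condensateOccupation N L Ψ.ψ := by
  obtain ⟨hmeas, R₀, hvR⟩ := hv
  -- finite range ⇒ finite scattering length
  have hatop : scatteringLength v ≠ ⊤ := by
    have hR : 0 ≤ max R₀ 0 := le_max_right _ _
    exact ne_top_of_le_ne_top ENNReal.ofReal_ne_top
      (scatteringLength_le_range hR fun r hr => hvR r ((le_max_left _ _).trans_lt hr))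
  obtain ⟨ρ₁, hρ₁, H⟩ := periodicGroundStateEnergy_le_one_add_mul_dilute hmeas hvR hatop
    (by norm_num : (0 : ℝ) < 1 / 10)
  refine ⟨ρ₁, hρ₁, fun ρ hρ hρlt => ?_⟩
  filter_upwards [H ρ hρ hρlt, eventually_gt_atTop 0] with N hE0 hN0
  intro Ψ A hA
  dsimp only
  intro hShell hΨ
  have hL : 0 < sideLength ρ N := by
    unfold sideLength; exact Real.rpow_pos_of_pos (div_pos (by exact_mod_cast hN0) hρ) _
  have h8 : 0 < 8 * Real.pi * ρ * (scatteringLength v).toReal := by positivity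
  have hκ : 0 < Real.sqrt (8 * Real.pi * ρ * (scatteringLength v).toReal) := Real.sqrt_pos.mpr h8
  have hκ2 : Real.sqrt (8 * Real.pi * ρ * (scatteringLength v).toReal) ^ 2 =
      8 * Real.pi * ρ * (scatteringLength v).toReal := Real.sq_sqrt h8.le
  -- total energy budget `e = 1.3 · 4πρa`
  have hE : periodicEnergy v Ψ ≤
      ENNReal.ofReal ((13 / 10) * (4 * Real.pi * ρ * (scatteringLength v).toReal) * N) := by
    refine hΨ.trans ?_
    calc periodicGroundStateEnergy v N (sideLength ρ N) +
          ENNReal.ofReal (4 * Real.pi * ρ * (scatteringLength v).toReal / 5 * N)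
        ≤ ENNReal.ofReal ((1 + 1 / 10) * (4 * Real.pi * ρ * (scatteringLength v).toReal * N)) +
            ENNReal.ofReal (4 * Real.pi * ρ * (scatteringLength v).toReal / 5 * N) :=
          add_le_add hE0 le_rfl
      _ = ENNReal.ofReal ((13 / 10) * (4 * Real.pi * ρ * (scatteringLength v).toReal) * N) := by
          rw [← ENNReal.ofReal_add (by positivity) (by positivity)]
          congr 1; ring
  have hmain := condensate_ge_of_shellLaw_of_energy_le hL v Ψ hκ hA (by positivity) hShell hE
  rw [hκ2] at hmain
  refine le_trans (le_of_eq ?_) hmain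
  congr 1
  field_simp
  ring

end Literature.MathematicalPhysics.QuantumManyBody.BoseGas
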